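import Literature.NumberTheory.EllipticCurves.KuriharaNumber
import Literature.NumberTheory.EllipticCurves.KatoKolyvaginPrimes
import Literature.NumberTheory.EllipticCurves.KuriharaNumberKimStructure
import Literature.NumberTheory.EllipticCurves.Sha
import HarnessLib

/-!
# Kim's structure theorem, clause (6): the length of `Ш(E/ℚ)[p^∞]` from Kurihara numbers, at a SEMI-STABLE prime

Topic `NumberTheory/EllipticCurves`; namespace `Literature.NumberTheory.EllipticCurves`. Two named facts
(`def … : Prop`, D-0014), siblings of `Kim2022_selmerCorank_le_of_kuriharaNumber_ne_zero`
(`KuriharaNumberKimStructure`, corank clause (1), good `p`) and `Kim2022_kuriharaNumber_certificate`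
(`KuriharaNumberKimCertificate`, Thm. 1.11, good ordinary `p`): here clause (6) of the same theorem
— the exact length of `Ш(E/ℚ)[p^∞]` — in the two shapes met in analytic rank `≤ 1`, and at a prime `p`
of GOOD OR MULTIPLICATIVE reduction (Kim's "semi-stable reduction prime"). Written for the residual cell
`b2b-bsdres` (class X11: `p ∥ N`, `ρ̄_{E,p}` irreducible, no second ramified multiplicative prime),
prover x11a gen 12; consumers in `Rank1Residual/Typed/KimCertificate.lean`.

## The printed statements (C.-H. Kim, *The structure of Selmer groups and the Iwasawa main conjecture
for elliptic curves*, Amer. J. Math. 148 (2026), no. 1, 79–129 = arXiv:2203.12159; held text = arXiv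
v3/v4, whose numbering is used, see the NUMBERING NOTE of `KuriharaNumberKimStructure`: Thm. 1.9 of
v3/v4 = **Thm. 1.8** of the journal version, statement byte-identical; Cor. 1.6 keeps its number)

* Thm. 1.1 (PDF p. 3): "Let `E` be an elliptic curve over `ℚ` and `p ≥ 5` a semi-stable reduction
  prime [footnote: It means that `E` has good or multiplicative reduction at `p`] for `E` such that the
  mod `p` representation `ρ̄ : Gal(ℚ̄/ℚ) → Aut_{𝔽_p}(E[p])` is surjective. If the Iwasawa main
  conjecture inverting `p` holds or `ord_{s=1} L(E,s) ≤ 1`, then … the structure of Selmer group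
  `Sel(ℚ, E[p^∞])` … is completely determined by the collection of Kurihara numbers as described in
  Theorem 1.9. If we assume the finiteness of `Ш(E/ℚ)[p^∞]` as well, then the explicit formulas for
  the rank of `E(ℚ)` and the exact size of `Ш(E/ℚ)[p^∞]` are also provided in Theorem 1.9." and
  (same page) "When `ord_{s=1} L(E,s) ≤ 1`, the Iwasawa main conjecture is not used … we obtain an
  explicit formula for the exact size of `Ш(E/ℚ)[p^∞]` for semi-stable elliptic curve `E` of analytic
  rank `≤ 1` and every prime `p ≥ 5` with the surjectivity condition but with no use of the Iwasawa
  main conjecture".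
* §1.4.1–1.4.4, §1.5.1 (PDF p. 7): `[r]⁺` defined by `2π ∫₀^∞ f(r + iy) dy = [r]⁺ Ω⁺_E + [r]⁻ √-1 Ω⁻_E`,
  "the real Néron period `Ω⁺_E` of `E` is taken as the absolute value of the integral of an invariant
  differential of a global minimal Weierstrass model of `E` over `E(ℝ)`"; `𝒫_k`, `𝒩_k`, `I_n` (§1.2.2);
  `δ̃_n = ∑_{a ∈ (ℤ/n)ˣ} \overline{[a/n]⁺} ∏_{ℓ∣n} \overline{log_{η_ℓ}(a)} ∈ ℤ_p/I_nℤ_p`, "well-defined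
  up to `(ℤ_p/I_nℤ_p)ˣ`"; "`δ̃_1 = [0]⁺ = L(E,1)/Ω⁺_E`"; `ord(δ̃) = min{ν(n) : n ∈ 𝒩_1, δ̃_n ≠ 0}`;
  "`∂^{(0)}(δ̃)` the `p`-adic valuation of `δ̃_1`", `∂^{(i)}(δ̃) = min{j : δ̃_n ∈ p^j ℤ_p/I_nℤ_p for every
  n ∈ 𝒩_1 with ν(n) = i}`, `∂^{(∞)}(δ̃) = min{∂^{(i)}(δ̃) : 0 ≤ i}`.
* **Theorem 1.9** (PDF pp. 7–8). "Let `E` be an elliptic curve over `ℚ` and `p ≥ 5` a prime such that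
  `ρ̄` is surjective and the Manin constant is prime to `p`. If `ord(δ̃) < ∞`, then
  (1) `cork_{ℤ_p} Sel(ℚ, E[p^∞]) = ord(δ̃)` …
  (3) `length_{ℤ_p}(Sel(ℚ, E[p^∞])_{/div}) = ∂^{(ord(δ̃))}(δ̃) − ∂^{(∞)}(δ̃)`. …
  If we further assume the finiteness of `Ш(E/ℚ)[p^∞]`, then we have (4) `rk_ℤ E(ℚ) = ord(δ̃)`, …
  (6) `length_{ℤ_p}(Ш(E/ℚ)[p^∞]) = ∂^{(ord(δ̃))}(δ̃) − ∂^{(∞)}(δ̃)`."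
* **Corollary 1.6** (PDF p. 6). "Let … `p ≥ 5` … such that `ρ̄` is surjective, and the Manin constant
  is prime to `p`. … In particular, if one of the following holds: `E` has good ordinary reduction at
  `p`, `E` has analytic rank zero, or `E` has analytic rank one and `E` has semi-stable reduction at
  `p`, then `δ̃` does not vanish identically." (Proof, PDF p. 6: rank zero — Kato's explicit
  reciprocity law; rank one at a semi-stable reduction prime `p > 2` — the settlement of
  Perrin-Riou's conjecture, Bertolini–Darmon–Venerucci / Burungale–Skinner–Tian /
  Büyükboduk–Pollack–Sasaki.)
* §1.3.5 (PDF p. 6), after Cor. 1.6: "The Manin constant is not divisible by a prime `p ≥ 3` if `E` has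
  semi-stable reduction at `p` [Mazur 1978]. Thus, the Manin constant assumption is needed only when `E`
  has additive reduction at `p`." (Mazur, Invent. Math. 44 (1978), Cor. 4.1; tree fact
  `mazur_not_dvd_maninConstant_of_odd`, file `ManinConstantSemistablePrimewise`.)

## The two facts below (weaker than print)

RANK ZERO. Hypotheses: `W` globally minimal elliptic, `p ≥ 5` of good or multiplicative reduction,
`ρ̄_{E,p}` surjective, `L(E,1) ≠ 0` (so `δ̃_1 = [0]⁺ ≠ 0`, `ord(δ̃) = 0 < ∞`), `Ш(E/ℚ)` finite
(Kolyvagin–Kato; kept as a hypothesis), and ONE level `n ∈ 𝒩_1` at which the mod-`p` Kurihara number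
is a unit. Then `∂^{(ν(n))}(δ̃) = 0`, hence `∂^{(∞)}(δ̃) = 0`, and (6) reads
`length_{ℤ_p} Ш(E/ℚ)[p^∞] = ∂^{(0)}(δ̃) = ord_p([0]⁺) = ord_p(L(E,1)/Ω_E)`. Conclusion stated as:
`L(E,1)/Ω(W)` is a rational number `q` with `ord_p q = ord_p #Ш(E/ℚ)(p)` (the shape of bsd.S30,
`padicValRat_bsd_rank_zero`, WITHOUT the Tamagawa and torsion terms — exactly as printed: under BSD
a unit Kurihara number can only occur when `p ∤ ∏ c_ℓ`, Kim's Conjecture 1.10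
`∂^{(∞)}(δ̃) = ∑ ord_p(c_ℓ)`; the consumers add `p ∤ ∏ c_ℓ · #E(ℚ)_tors`).
RANK ONE. Hypotheses: as above but `L(E,1) = 0` (so `δ̃_1 = 0`, `ord(δ̃) ≥ 1`), analytic rank `1`, and a
unit mod-`p` Kurihara number at a PRIME level `ℓ ∈ 𝒫_1` (so `ord(δ̃) = 1 < ∞` and
`∂^{(1)} = ∂^{(∞)} = 0`), multiplicative or good reduction at `p` (Cor. 1.6's "semi-stable reduction at
`p`" is where the paper itself places the rank-one case); conclusion from (6):
`Ш(E/ℚ)[p^∞] = 0`, stated as `#Ш(E/ℚ)(p) = 1`.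

NORMALISATIONS (identical to the siblings, see `KuriharaNumberKimCertificate`, "The Lean statement and
its normalisation"): the tree's `kuriharaNumber f p n ψ` uses `[r]⁺_f = Re{∞,r}/Ω⁺_f`
(`ratPlusSymbol`, `plusPeriod f`), Kim's `δ̃_n` uses the Néron period of the minimal model
`Ω⁺_E = W.realPeriodRat` (components included, exactly the tree's convention); the EXPLICIT hypothesis
`Ω(W) = u · Ω⁺_f`, `u ∈ ℚ`, `|u|_p = 1` makes `kuriharaNumber f p n ψ = ū · δ̃_n^{(1)}` with `ū ∈ 𝔽_pˣ`,
so "`δ̃_n ≢ 0 (mod p)`" is literally "`kuriharaNumber f p n ψ ≠ 0`" (and `ψ_ℓ` ranges over surjective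
discrete logarithms `(ℤ/ℓ)ˣ → ℤ/p`; the choice changes `δ̃_n` by a unit). The period hypothesis is a
theorem at every `p ≥ 5` with `p² ∤ N` and `E[p]` irreducible (Greenberg–Vatsal 2000 Rem. 3.4 +
Mazur 1978 Cor. 4.1 + Edixhoven 1991; tree facts `realPeriodRat_eq_unit_mul_plusPeriod` (good `p`),
`realPeriodRat_eq_unit_mul_plusPeriod_of_multiplicative` (`p ∥ N`), file `ModularCurvePeriodRatio`).
LEVELS: as in `Kim2022_selmerCorank_le_of_kuriharaNumber_ne_zero_cyclicLevel_of` we add, faithful to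
the printed PROOF (Mazur–Rubin Kolyvagin systems; Kim Thm. 2.1 "`T/(Fr_ℓ - 1)T` is a cyclic
`ℤ_p`-module"), the cyclicity condition `#Ẽ(𝔽_ℓ)[p] ≤ p` at every prime `ℓ ∣ n` (see the CAVEAT in
`KuriharaNumberKimStructure`); weaker than the literal `𝒩_1`.
THE MANIN CONSTANT: Kim's hypothesis (ii) is rendered by restricting to a prime of semi-stable
reduction, where the source itself declares it vacuous (§1.3.5, Mazur Cor. 4.1 for the strong Weil
curve `E₀`; for another curve `W` of the isogeny class the modular symbols `[r]⁺_W = (Ω_{E₀}/Ω_W)[r]⁺_{E₀}`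
differ by the `p`-adic unit `Ω_{E₀}/Ω_W` and `Ш[p^∞]`, `Sel_{p^∞}` are unchanged along an isogeny of
degree prime to `p`, which is every isogeny of the class as `E[p]` is irreducible — Greenberg–Vatsal
2000, Rem. 3.4; this is the reading already used by `Kim2022_selmerCorank_le_of_kuriharaNumber_ne_zero`).
Not here: clauses (2), (3), (5) (higher Fitting ideals / the full elementary-divisor structure), the
`p^k` versions; no `_holds` (the proof is the whole paper: Mazur–Rubin, Kato's Euler
system and explicit reciprocity law, Perrin-Riou's conjecture; literature-prover triage size XL).
Additive `p`: the THIRD (rank zero) and FOURTH (rank one) facts, appended below the first two (harvest seat 2, gen 5) — the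
same unit-Kurihara-number shapes with NO reduction hypothesis and Kim's Manin hypothesis carried explicitly by a
modular parametrisation datum, see their section docstrings.

## References

* C.-H. Kim, Amer. J. Math. 148 (2026) 79–129 = arXiv:2203.12159, Thm. 1.1, Cor. 1.6, §1.3.5, §1.4,
  §1.5.1, Thm. 1.9 (= Thm. 1.8 of the journal version). [Kim2022StructureSelmer]
* B. Mazur, Invent. Math. 44 (1978), Cor. 4.1. [Mazur1978]
* R. Greenberg, V. Vatsal, Invent. Math. 142 (2000), §3, Rem. 3.4. [GreenbergVatsal2000]
-/

noncomputable section

open scoped MatrixGroups ModularForm Classical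

open CongruenceSubgroup Literature.NumberTheory.EllipticCurves.ModularForms

namespace Literature.NumberTheory.EllipticCurves

/-- **Kim's structure theorem, clause (6), analytic rank `0`, unit Kurihara number** (C.-H. Kim,
Amer. J. Math. 148 (2026), Thm. 1.8 = arXiv:2203.12159v4 **Thm. 1.9 (1), (6)** with Cor. 1.6 and
§1.3.5, PDF pp. 6–8; see the module docstring for the verbatim statements and the normalisations).
Let `W/ℚ` be a globally minimal elliptic curve, `p ≥ 5` a prime of good or multiplicative ("semi-stable")
reduction with `ρ̄_{E,p}` surjective; assume `L(E,1) ≠ 0` (so `ord(δ̃) = 0`) and `Ш(E/ℚ)` finite; let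
`f` be the newform of `W` with the period transfer `Ω(W) = u · Ω⁺_f`, `|u|_p = 1`; let `n ∈ 𝒩_1` be a
square-free product of Kolyvagin primes (`ℓ ∤ Np`, `ℓ ≡ 1`, `a_ℓ ≡ ℓ + 1 (mod p)`) all of whose prime
factors satisfy the cyclicity condition `#Ẽ(𝔽_ℓ)[p] ≤ p`, and `ψ_ℓ : (ℤ/ℓ)ˣ ↠ ℤ/p` discrete
logarithms with `kuriharaNumber f p n ψ ≠ 0` (i.e. `δ̃_n^{(1)} ≠ 0`, whence `∂^{(∞)}(δ̃) = 0`). Then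
`length_{ℤ_p} Ш(E/ℚ)[p^∞] = ∂^{(0)}(δ̃) = ord_p(L(E,1)/Ω⁺_E)`: there is `q ∈ ℚ` with
`L(E,1)/Ω(W) = q` and `ord_p q = ord_p #Ш(E/ℚ)(p)`. Weaker than print. No `_holds` (size XL).
**FLAG `K26-(6)-shallow@t>0`** (ARM P D-audit, reader bsd-cited-r10, sheet `D-AUDIT-r10.md` sha16
cfa522325b7b7321 §D.2 F2 — STRONGER-THAN-PROOF ⇒ narrow; typer bsd-cited-ty2, 2026-08-26): with
`t := ord_p #E(ℚ_p)[p^∞]`, the printed proof controls `x_n = u · p^t · δ̃_n ∈ ℤ/p^{k(n)}` (Thm. 3.13)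
only at DEEP levels (§5.4.3), so on a `t ≥ 1` row (Prop. 3.2: good anomalous `p` with a local
`p`-torsion point) this LEVEL-ONE certificate is not covered by the displayed argument (it rests on
§1.5.1's asserted `lim`); at `t = 0` it is. PROOF-COVERED TWIN: `…_of_localTorsionTrivial` in
`KuriharaNumberKimShaLengthLocalTorsionTrivial` (one extra binder `#E(ℚ_p)[p] = 1`; bridge proved);
this decl is KEPT byte-identical for its importers.
[cite: Kim2022StructureSelmer, Thm. 1.9 (1) and (6) (PDF pp. 7–8), Cor. 1.6 (PDF p. 6), §1.3.5, §1.4.1–1.4.4, §1.5.1]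
[cite: Mazur1978, Cor. 4.1] [cite: GreenbergVatsal2000, §3, Remark 3.4] -/
def Kim2022_rankZero_padicValRat_sha_of_kuriharaNumber_ne_zero : Prop :=
  ∀ (W : WeierstrassCurve ℚ) [W.IsElliptic] [W.IsGloballyMinimal] (p : ℕ) [Fact p.Prime],
    5 ≤ p → (W.HasGoodReductionAtPrime p ∨ W.HasMultiplicativeReductionAtPrime p) →
    W.HasSurjectiveModNGaloisRep p →
    W.entireLFunction 1 ≠ 0 → Finite W.sha →
    ∀ {N : ℕ} [NeZero N] (f : CuspForm (Gamma0 N) 2), IsNewformOf W f →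
    (∃ u : ℚ, ‖(u : ℚ_[p])‖ = 1 ∧ W.realPeriodRat = u * plusPeriod f) →
    ∀ (n : ℕ) [NeZero n], Kato.IsKolyvaginProduct W p 1 n →
    (∀ (ℓ : ℕ) [Fact ℓ.Prime], ℓ ∣ n →
      Nat.card {P : ((WeierstrassCurve.integralModelInt W).map
          (Int.castRingHom (ZMod ℓ))).toAffine.Point // p • P = 0} ≤ p) →
    ∀ ψ : (ℓ : ℕ) → (ZMod ℓ)ˣ →* Multiplicative (ZMod (p ^ 1)),
      (∀ ℓ ∈ n.primeFactors, Function.Surjective (ψ ℓ)) →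
      kuriharaNumber f (p ^ 1) n ψ ≠ 0 →
    ∃ q : ℚ, W.entireLFunction 1 / (W.realPeriodRat : ℂ) = (q : ℂ) ∧
      padicValRat p q = (padicValNat p (Nat.card (AddCommGroup.primaryComponent W.sha p)) : ℤ)

/-- **Kim's structure theorem, clause (6), analytic rank `1`, unit Kurihara number at a prime level**
(C.-H. Kim, Amer. J. Math. 148 (2026), Thm. 1.8 = arXiv:2203.12159v4 **Thm. 1.9 (1), (6)** with
**Cor. 1.6** ("`E` has analytic rank one and `E` has semi-stable reduction at `p`") and §1.3.5, PDF
pp. 6–8; module docstring). Let `W/ℚ` be globally minimal elliptic, `p ≥ 5` of good or multiplicative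
reduction, `ρ̄_{E,p}` surjective, `L(E,1) = 0` and `ord_{s=1} L(E,s) = 1` (so `δ̃_1 = [0]⁺ = 0` and
`ord(δ̃) ≥ 1`), `Ш(E/ℚ)` finite; `f`, `u` as in the rank-zero fact; `ℓ` a Kolyvagin prime of level `1`
(`ℓ ∤ Np`, `ℓ ≡ 1`, `a_ℓ ≡ ℓ + 1 (mod p)`) with `#Ẽ(𝔽_ℓ)[p] ≤ p`, and `ψ` with `ψ_ℓ : (ℤ/ℓ)ˣ ↠ ℤ/p`
and `kuriharaNumber f p ℓ ψ ≠ 0` (so `ord(δ̃) = 1` and `∂^{(1)}(δ̃) = ∂^{(∞)}(δ̃) = 0`). Then (6)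
gives `length_{ℤ_p} Ш(E/ℚ)[p^∞] = 0`: `#Ш(E/ℚ)(p) = 1`. Weaker than print. No `_holds` (size XL).
**FLAG `K26-(6)-shallow@t>0`** (ARM P sheet cfa522325b7b7321 §D.2 F2; see the rank-zero sibling
above): level-ONE certificate ⇒ covered by the printed proof only at `t = ord_p #E(ℚ_p)[p^∞] = 0`;
PROOF-COVERED TWIN `…_of_localTorsionTrivial` in `KuriharaNumberKimShaLengthLocalTorsionTrivial`
(bridge proved); this decl is KEPT byte-identical.
[cite: Kim2022StructureSelmer, Thm. 1.9 (1) and (6) (PDF pp. 7–8), Cor. 1.6 (PDF p. 6), §1.3.5, §1.4.1–1.4.4, §1.5.1]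
[cite: Mazur1978, Cor. 4.1] [cite: GreenbergVatsal2000, §3, Remark 3.4] -/
def Kim2022_rankOne_card_sha_eq_one_of_kuriharaNumber_ne_zero : Prop :=
  ∀ (W : WeierstrassCurve ℚ) [W.IsElliptic] [W.IsGloballyMinimal] (p : ℕ) [Fact p.Prime],
    5 ≤ p → (W.HasGoodReductionAtPrime p ∨ W.HasMultiplicativeReductionAtPrime p) →
    W.HasSurjectiveModNGaloisRep p →
    W.entireLFunction 1 = 0 → W.analyticRank = 1 → Finite W.sha →
    ∀ {N : ℕ} [NeZero N] (f : CuspForm (Gamma0 N) 2), IsNewformOf W f →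
    (∃ u : ℚ, ‖(u : ℚ_[p])‖ = 1 ∧ W.realPeriodRat = u * plusPeriod f) →
    ∀ (ℓ : ℕ) [Fact ℓ.Prime], Kato.IsKolyvaginPrime W p 1 ℓ →
    Nat.card {P : ((WeierstrassCurve.integralModelInt W).map
        (Int.castRingHom (ZMod ℓ))).toAffine.Point // p • P = 0} ≤ p →
    ∀ ψ : (ℓ' : ℕ) → (ZMod ℓ')ˣ →* Multiplicative (ZMod (p ^ 1)),
      Function.Surjective (ψ ℓ) →
      kuriharaNumber f (p ^ 1) ℓ ψ ≠ 0 →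
    Nat.card (AddCommGroup.primaryComponent W.sha p) = 1

/-! ### The rank-zero clause at ANY prime `p ≥ 5` — additive reduction included (appended by the
residual cell's harvest seat 2, gen 5; class X4 = additive `p`, `E[p]` irreducible)

The printed Theorem 1.9 (= Thm. 1.8 of Amer. J. Math. 148) carries NO hypothesis on the reduction of
`E` at `p`. Verbatim, the standing assumptions of §1.4.1 (PDF p. 7): "Let `p ≥ 5` be a prime and `E` an
elliptic curve over `ℚ` such that the residual representation `ρ̄` is irreducible and the Manin constant
is prime to `p`. … Under our assumptions, we have `[r]⁺ ∈ ℤ_(p)`"; Theorem 1.9 (PDF pp. 7–8): "Let `E`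
be an elliptic curve over `ℚ` and `p ≥ 5` a prime such that `ρ̄` is surjective and the Manin constant
is prime to `p`. If `ord(δ̃) < ∞`, then (1) `cork_{ℤ_p} Sel(ℚ, E[p^∞]) = ord(δ̃)` … If we further
assume the finiteness of `Ш(E/ℚ)[p^∞]`, then … (6) `length_{ℤ_p}(Ш(E/ℚ)[p^∞]) = ∂^{(ord(δ̃))}(δ̃) −
∂^{(∞)}(δ̃)`"; §1.4.3: "When `n = 1`, we have `δ̃_1 = [0]⁺ = L(E,1)/Ω⁺_E ∈ ℤ_(p)`" — so in analytic rank
`0` one has `ord(δ̃) = 0 < ∞` with no appeal to Cor. 1.6 — and §1.3.5 (PDF p. 6): "the Manin constant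
assumption is needed only when `E` has additive reduction at `p`". The ADDITIVE case is treated inside
the proof, not excluded: Prop. 3.2 (PDF p. 15: "`E(ℚ_p)[p] ≠ 0` if and only if … `E` has additive
reduction at `p` with minimal Weierstrass equation … `a_i ∈ pℤ_p` … satisfying `p = 5` and
`a₄ ≡ 10 (mod 25)`, or `p = 7` and `a₆ ≡ 14 (mod 49)` [, …]", citing Kim–Nakamura and Kosters–Pannekoek)
and Lemma 3.10 (PDF p. 17: "If `E` has additive reduction at `p ≥ 3`, then
`exp*_{ω_E}(H¹(ℚ_p, T)) = (1/p^t)ℤ_p`"). An independent printed source for the additive case under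
extra hypotheses is C.-H. Kim, K. Nakamura, J. Number Theory 210 (2020) 249–279, Thm. 1.7 ("Let `E` be
an elliptic curve with additive reduction at `p > 7` satisfying Assumption 1.1 [`p ∤ Tam(E)·∏_{ℓ∣N_st}
(ℓ−1)·∏_{ℓ∣N_ns}(ℓ+1)`, `ρ̄` surjective, Manin constant prime to `p`]. Suppose that `L(E,1) ≠ 0`. If
`δ̃_n ≠ 0 ∈ 𝔽_p` for some square-free product of Kolyvagin primes `n`, then …
`ord_p(#Ш(E/ℚ)[p^∞]) = ord_p(L(E,1)/Ω⁺_E)`", with Remark 1.8 (1): also `p ≤ 7` outside the exceptional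
cases of their Assumption 2.5) — not typed separately (the fact below has fewer hypotheses).

The fact below is the rank-zero unit-Kurihara-number shape of the two siblings above with the
reduction hypothesis DROPPED (as printed) and Kim's hypothesis (ii) carried EXPLICITLY, in the form
already used by `Kim2022_kuriharaNumber_certificate` (file `KuriharaNumberKimCertificate`): a modular
parametrisation datum `D : ModularParametrizationData W N` (newform `D.f` of `W`, `φ^* ω_E = c · 2πi f dτ`,
`c = D.maninConstant`) with `p ∤ D.maninConstant`. Everything else — the period transfer
`Ω(W) = u · Ω⁺_f`, `|u|_p = 1` (turning Kim's Néron-normalised `δ̃_n` into `ū · kuriharaNumber D.f p n ψ`,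
`ū ∈ 𝔽_pˣ`), the level `n ∈ 𝒩_1` (`Kato.IsKolyvaginProduct W p 1 n`), the cyclicity condition
`#Ẽ(𝔽_ℓ)[p] ≤ p` at `ℓ ∣ n` (faithful to the proof, weaker than the literal `𝒩_1`), the surjective
discrete logarithms, `Ш(E/ℚ)` finite as a binder, and the conclusion `ord_p(L(E,1)/Ω(W)) = ord_p #Ш(E/ℚ)(p)`
— is IDENTICAL to `Kim2022_rankZero_padicValRat_sha_of_kuriharaNumber_ne_zero`. At a prime of good or
multiplicative reduction that sibling is the better citation (no datum needed: Mazur 1978 Cor. 4.1);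
the present fact is the one a pair with `p² ∣ N` consumes (the residual cell's class X4 in analytic
rank `0`: e.g. the eleven pairs of conductor `< 2·10⁴` at `p = 5` with `5 ∤ Tam(E)`, `#Ш_an = 25`
listed in the cell's RECLASSIFY §GEN-5; there `p ∤ c` is Agashe–Ribet–Stein 2006, appendix Thm. 5.2,
for the optimal curve of conductor `< 60000`). As for the siblings: under BSD a unit `δ̃_n` can only
occur when `p ∤ ∏ c_ℓ` (Kim's Conjecture 1.10), and the consumers add `p ∤ ∏ c_ℓ · #E(ℚ)_tors`.
Weaker than print (period binder, cyclicity), never stronger. No `_holds` (size XL: the whole paper). -/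

/-- **Kim's structure theorem, clause (6), analytic rank `0`, unit Kurihara number, ANY reduction type
at `p` (additive included)** (C.-H. Kim, Amer. J. Math. 148 (2026) 79–129, Thm. 1.8 = arXiv:2203.12159v4
**Thm. 1.9 (1), (6)**, with §1.4.1, §1.4.3 (`δ̃_1 = [0]⁺ = L(E,1)/Ω⁺_E`), §1.3.5, Prop. 3.2, Lemma 3.10;
PDF pp. 6–8, 15, 17; see the section docstring above for the verbatim statements). Let `W/ℚ` be a
globally minimal elliptic curve and `p ≥ 5` a prime — NO hypothesis on the reduction of `W` at `p` —
with `ρ̄_{E,p}` surjective; let `D` be a modular parametrisation datum of `W` at level `N` whose Manin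
constant is prime to `p` (Kim's hypothesis, needed exactly when `p² ∣ N`); assume `L(E,1) ≠ 0` (so
`ord(δ̃) = 0`) and `Ш(E/ℚ)` finite; assume the period transfer `Ω(W) = u · Ω⁺_{D.f}`, `u ∈ ℚ`,
`|u|_p = 1`; let `n ∈ 𝒩_1` be a square-free product of Kolyvagin primes (`ℓ ∤ Np`, `ℓ ≡ 1`,
`a_ℓ ≡ ℓ + 1 (mod p)`) all of whose prime factors satisfy `#Ẽ(𝔽_ℓ)[p] ≤ p`, and `ψ_ℓ : (ℤ/ℓ)ˣ ↠ ℤ/p`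
discrete logarithms with `kuriharaNumber D.f p n ψ ≠ 0` (i.e. `δ̃_n^{(1)} ≠ 0`, whence `∂^{(∞)}(δ̃) = 0`).
Then `length_{ℤ_p} Ш(E/ℚ)[p^∞] = ∂^{(0)}(δ̃) = ord_p(L(E,1)/Ω⁺_E)`: there is `q ∈ ℚ` with
`L(E,1)/Ω(W) = q` and `ord_p q = ord_p #Ш(E/ℚ)(p)`. Weaker than print. No `_holds` (size XL).
**FLAG `K26-(6)-shallow@t>0`** (ARM P sheet cfa522325b7b7321 §D.2 F2; see the first fact of this
file): level-ONE certificate ⇒ covered by the printed proof only at `t = ord_p #E(ℚ_p)[p^∞] = 0` (by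
Prop. 3.2, `t ≥ 1` here also on additive `p = 5`, `a₄ ≡ 10 (mod 25)` and `p = 7`, `a₆ ≡ 14 (mod 49)`);
PROOF-COVERED TWIN `…_of_maninConstant_of_localTorsionTrivial` in
`KuriharaNumberKimShaLengthLocalTorsionTrivial` (bridge proved); this decl is KEPT byte-identical.
[cite: Kim2022StructureSelmer, Thm. 1.9 (1) and (6) (PDF pp. 7–8), §1.4.1 and §1.4.3–1.4.4 (PDF p. 7), §1.3.5 (PDF p. 6), Prop. 3.2 (PDF p. 15), Lemma 3.10 (PDF p. 17)]
[cite: KimNakamura2020, Thm. 1.7 with Assumption 1.1 and Remark 1.8 (1) (pp. 250–251)] -/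
def Kim2022_rankZero_padicValRat_sha_of_kuriharaNumber_ne_zero_of_maninConstant : Prop :=
  ∀ (W : WeierstrassCurve ℚ) [W.IsElliptic] [W.IsGloballyMinimal] (p : ℕ) [Fact p.Prime],
    5 ≤ p → W.HasSurjectiveModNGaloisRep p →
    W.entireLFunction 1 ≠ 0 → Finite W.sha →
    ∀ {N : ℕ} [NeZero N] (D : ModularParametrizationData W N),
    ¬ (p : ℤ) ∣ D.maninConstant →
    (∃ u : ℚ, ‖(u : ℚ_[p])‖ = 1 ∧ W.realPeriodRat = u * plusPeriod D.f) →
    ∀ (n : ℕ) [NeZero n], Kato.IsKolyvaginProduct W p 1 n →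
    (∀ (ℓ : ℕ) [Fact ℓ.Prime], ℓ ∣ n →
      Nat.card {P : ((WeierstrassCurve.integralModelInt W).map
          (Int.castRingHom (ZMod ℓ))).toAffine.Point // p • P = 0} ≤ p) →
    ∀ ψ : (ℓ : ℕ) → (ZMod ℓ)ˣ →* Multiplicative (ZMod (p ^ 1)),
      (∀ ℓ ∈ n.primeFactors, Function.Surjective (ψ ℓ)) →
      kuriharaNumber D.f (p ^ 1) n ψ ≠ 0 →
    ∃ q : ℚ, W.entireLFunction 1 / (W.realPeriodRat : ℂ) = (q : ℂ) ∧
      padicValRat p q = (padicValNat p (Nat.card (AddCommGroup.primaryComponent W.sha p)) : ℤ)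

/-! ### The rank-one clause at ANY prime `p ≥ 5` — additive reduction included (harvest seat 2, gen 5)

Theorem 1.9's only hypotheses are `p ≥ 5`, `ρ̄` surjective, the Manin constant prime to `p`, and
`ord(δ̃) < ∞` (§1.4.4, PDF p. 7: "`ord(δ̃) = min{ν(n) : n ∈ 𝒩_1, δ̃_n ≠ 0}`"); for (4)–(6) also the
finiteness of `Ш(E/ℚ)[p^∞]`. Corollary 1.6 ("`E` has analytic rank one and `E` has semi-stable
reduction at `p`") is one of three printed SUFFICIENT conditions for `ord(δ̃) < ∞`; it is not a
hypothesis of Theorem 1.9. In the certificate shape below the finiteness of `ord(δ̃)` is WITNESSED by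
the certificate itself: `L(E,1) = 0` gives `δ̃_1 = [0]⁺ = L(E,1)/Ω⁺_E = 0` (§1.4.3), hence
`ord(δ̃) ≥ 1`, and a Kolyvagin prime `ℓ ∈ 𝒫_1` with `δ̃_ℓ^{(1)} ≠ 0` in `𝔽_p` (so `δ̃_ℓ ≠ 0` in
`ℤ_p/I_ℓℤ_p`, `I_ℓ ⊆ pℤ_p`) gives `ord(δ̃) = 1 < ∞`, `∂^{(1)}(δ̃) = 0` and therefore `∂^{(∞)}(δ̃) = 0`
(§1.5.1); clause (6) then reads `length_{ℤ_p} Ш(E/ℚ)[p^∞] = ∂^{(1)}(δ̃) − ∂^{(∞)}(δ̃) = 0` and clause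
(4) `rk_ℤ E(ℚ) = 1`. No reduction hypothesis enters (Theorem 1.9 has none; the additive case is inside
its proof, Prop. 3.2 / Lemma 3.10, see the previous section docstring), so the semi-stable restriction
of `Kim2022_rankOne_card_sha_eq_one_of_kuriharaNumber_ne_zero` — placed there after Cor. 1.6's wording —
is not needed once a non-zero `δ̃_ℓ` is part of the hypotheses; what IS needed at an additive `p` is
Kim's Manin hypothesis, carried as in the rank-zero fact above by a datum `D` with `p ∤ D.maninConstant`.
Consumers: the residual cell's class X4 in analytic rank `1` (per pair; e.g. the 26 pairs of conductor
`< 2·10⁴` at `p ∈ {5, 7}` with `ρ̄` onto and `p ∤ ∏ c_ℓ · #Ш_an` listed in the cell's RECLASSIFY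
§GEN-5), through the same `Typed.bsdp_of_shaAn_unit_of_noPTorsion` route as the semi-stable sibling. -/

/-- **Kim's structure theorem, clauses (1), (4), (6), analytic rank `1`, unit Kurihara number at a
PRIME level, ANY reduction type at `p` (additive included)** (C.-H. Kim, Amer. J. Math. 148 (2026),
Thm. 1.8 = arXiv:2203.12159v4 **Thm. 1.9 (1), (4), (6)** with §1.4.1, §1.4.3–1.4.4, §1.5.1, §1.3.5,
Prop. 3.2, Lemma 3.10; PDF pp. 6–8, 15, 17; section docstrings above for the verbatim statements).
Let `W/ℚ` be a globally minimal elliptic curve, `p ≥ 5` a prime — NO hypothesis on the reduction of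
`W` at `p` — with `ρ̄_{E,p}` surjective; `D` a modular parametrisation datum of `W` at level `N` with
`p ∤ D.maninConstant`; `L(E,1) = 0` and `ord_{s=1} L(E,s) = 1`; `Ш(E/ℚ)` finite; the period transfer
`Ω(W) = u · Ω⁺_{D.f}`, `|u|_p = 1`; `ℓ` a Kolyvagin prime of level `1` (`ℓ ∤ Np`, `ℓ ≡ 1`,
`a_ℓ ≡ ℓ + 1 (mod p)`) with `#Ẽ(𝔽_ℓ)[p] ≤ p`, and `ψ` with `ψ_ℓ : (ℤ/ℓ)ˣ ↠ ℤ/p` and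
`kuriharaNumber D.f p ℓ ψ ≠ 0` (so `ord(δ̃) = 1 < ∞` is witnessed and `∂^{(1)}(δ̃) = ∂^{(∞)}(δ̃) = 0`).
Then (6) gives `length_{ℤ_p} Ш(E/ℚ)[p^∞] = 0`: `#Ш(E/ℚ)(p) = 1`. Weaker than print (period binder,
cyclicity), never stronger. No `_holds` (size XL). **FLAG `K26-(6)-shallow@t>0`** (ARM P sheet
cfa522325b7b7321 §D.2 F2; as the rank-zero sibling above): PROOF-COVERED TWIN
`…_of_maninConstant_of_localTorsionTrivial` in `KuriharaNumberKimShaLengthLocalTorsionTrivial`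
(bridge proved); this decl is KEPT byte-identical.
[cite: Kim2022StructureSelmer, Thm. 1.9 (1), (4) and (6) (PDF pp. 7–8), §1.4.1 and §1.4.3–1.4.4 (PDF p. 7), §1.5.1 (PDF p. 7), §1.3.5 (PDF p. 6), Prop. 3.2 (PDF p. 15), Lemma 3.10 (PDF p. 17)] -/
def Kim2022_rankOne_card_sha_eq_one_of_kuriharaNumber_ne_zero_of_maninConstant : Prop :=
  ∀ (W : WeierstrassCurve ℚ) [W.IsElliptic] [W.IsGloballyMinimal] (p : ℕ) [Fact p.Prime],
    5 ≤ p → W.HasSurjectiveModNGaloisRep p →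
    W.entireLFunction 1 = 0 → W.analyticRank = 1 → Finite W.sha →
    ∀ {N : ℕ} [NeZero N] (D : ModularParametrizationData W N),
    ¬ (p : ℤ) ∣ D.maninConstant →
    (∃ u : ℚ, ‖(u : ℚ_[p])‖ = 1 ∧ W.realPeriodRat = u * plusPeriod D.f) →
    ∀ (ℓ : ℕ) [Fact ℓ.Prime], Kato.IsKolyvaginPrime W p 1 ℓ →
    Nat.card {P : ((WeierstrassCurve.integralModelInt W).map
        (Int.castRingHom (ZMod ℓ))).toAffine.Point // p • P = 0} ≤ p →
    ∀ ψ : (ℓ' : ℕ) → (ZMod ℓ')ˣ →* Multiplicative (ZMod (p ^ 1)),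
      Function.Surjective (ψ ℓ) →
      kuriharaNumber D.f (p ^ 1) ℓ ψ ≠ 0 →
    Nat.card (AddCommGroup.primaryComponent W.sha p) = 1

/-! ## The rank-one clause at a Kolyvagin prime of LEVEL TWO: the INEQUALITY `length Ш[p^∞] ≤ 1`

APPEND (cell `b2b-bsdres`, harvest seat 2 GEN 6, 2026-08-20). The two rank-one facts above render
clause (6) of Kim's Theorem 1.9 when the certificate is a UNIT Kurihara number `δ̃_ℓ ≢ 0 (mod p)` at
a Kolyvagin prime of level `1` (`∂^{(1)}(δ̃) = 0`, hence `Ш(E/ℚ)[p^∞] = 0`). By Kim's Conjecture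
1.10 (`∂^{(∞)}(δ̃) = ∑_ℓ ord_p c_ℓ`, PDF p. 8) no such unit exists when `p ∣ ∏_ℓ c_ℓ(E)`: there the
informative certificate lives one level up. Kim's sets of Kolyvagin primes are nested,
`𝒫_{k+1} ⊆ 𝒫_k` (§1.2.2, PDF p. 5: "`𝒫_k = {ℓ prime : (ℓ, Np) = 1, ℓ ≡ 1 (mod p^k),
a_ℓ(E) ≡ ℓ + 1 (mod p^k)}` … `I_ℓ = (ℓ − 1, a_ℓ − ℓ − 1)ℤ_p ⊆ ℤ_p` and `I_n = ∑_{ℓ∣n} I_ℓ`"), so for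
`ℓ ∈ 𝒫_2` the ideal `I_ℓ` lies in `p²ℤ_p` and the Kurihara number `δ̃_ℓ ∈ ℤ_p/I_ℓℤ_p` (§1.4.3) has
a well-defined reduction `δ̃_ℓ^{(2)} ∈ ℤ/p²ℤ` (§1.5.1: "write `δ̃_n^{(k)} = δ̃_n mod p^k ∈ ℤ/p^kℤ`
where `n ∈ 𝒩_k`"). §1.5.1 defines `∂^{(i)}(δ̃)` as the exponent `j` for which ALL `δ̃_n` with
`ν(n) = i` lie in `p^j ℤ_p/I_nℤ_p` (the `p`-divisibility shared by the whole collection; `∂^{(0)}(δ̃)`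
"the `p`-adic valuation of `δ̃_1`"). Consequently, if ONE `ℓ ∈ 𝒫_2` has `δ̃_ℓ^{(2)} ≠ 0` — i.e.
`δ̃_ℓ ∉ p² ℤ_p/I_ℓℤ_p` — then `δ̃_ℓ ≠ 0` in `ℤ_p/I_ℓℤ_p`, so with `δ̃_1 = [0]⁺ = L(E,1)/Ω⁺_E = 0`
(§1.4.3, `L(E,1) = 0`) one has `ord(δ̃) = 1 < ∞` (§1.4.4), and `∂^{(1)}(δ̃) ≤ 1`; clause (6) of
Theorem 1.9 (PDF p. 8: "If we further assume the finiteness of `Ш(E/ℚ)[p^∞]`, then …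
(6) `length_{ℤ_p}(Ш(E/ℚ)[p^∞]) = ∂^{(ord(δ̃))}(δ̃) − ∂^{(∞)}(δ̃)`", with `∂^{(∞)} ≥ 0`) gives
`length_{ℤ_p} Ш(E/ℚ)[p^∞] ≤ 1`, i.e. `ord_p #Ш(E/ℚ)(p) ≤ 1`. This INEQUALITY is the fact below —
weaker than print in every respect (an inequality read off an equality; the period-transfer binder;
the cyclicity flag `#Ẽ(𝔽_ℓ)[p] ≤ p` of the printed PROOF, as in every sibling; `Finite W.sha`); the
hypotheses of Theorem 1.9 (`p ≥ 5`, `ρ̄` surjective, Manin constant prime to `p` — carried by a datum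
`D` as in the `_of_maninConstant` siblings, needed only at an additive `p`, §1.3.5) are unchanged and
NO reduction hypothesis at `p` enters (Thm. 1.9 has none). Why it is useful: combined with Cassels'
theorem (`#Ш` is a perfect square, so `ord_p #Ш` is even) it forces `Ш(E/ℚ)[p^∞] = 0` on rank-one
pairs with `ord_p ∏ c_ℓ = 1` — the consumer lives under
`Summits/BirchSwinnertonDyer/Rank1Residual/Additive/RankOneTamagawaParity.lean`. In the tree's
vocabulary the certificate is `kuriharaNumber D.f (p^2) ℓ ψ ≠ 0` for `ℓ` with
`Kato.IsKolyvaginPrime W p 2 ℓ` and `ψ_ℓ : (ℤ/ℓ)ˣ ↠ ℤ/p²` (the symbols `[a/ℓ]⁺_f` are `p`-integral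
under the standing hypotheses, §1.4.1, and `Ω(W) = u·Ω⁺_f` with `|u|_p = 1` makes the `Ω⁺_f`- and
`Ω⁺_E`-normalised numbers differ by a `p`-adic unit, so non-vanishing mod `p²` is normalisation-free). -/

/-- **Kim's structure theorem, clause (6), analytic rank `1`, NON-ZERO Kurihara number MODULO `p²`
at a prime Kolyvagin level of LEVEL TWO, ANY reduction type at `p`: `ord_p #Ш(E/ℚ)(p) ≤ 1`**
(C.-H. Kim, Amer. J. Math. 148 (2026), Thm. 1.8 = arXiv:2203.12159v4 **Thm. 1.9 (6)** with §1.2.2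
(`𝒫_2`, `I_ℓ ⊆ p²ℤ_p`), §1.4.1, §1.4.3–1.4.4 (`δ̃_1 = L(E,1)/Ω⁺_E`, `ord(δ̃)`), §1.5.1
(`δ̃_n^{(k)}`, `∂^{(i)}`, `∂^{(∞)} ≥ 0`), §1.3.5; PDF pp. 5–8; the section docstring above for the
verbatim statements and the three-line derivation). Let `W/ℚ` be globally minimal, `p ≥ 5` — NO
hypothesis on the reduction of `W` at `p` — with `ρ̄_{E,p}` surjective; `D` a modular
parametrisation datum at level `N` with `p ∤ D.maninConstant`; `L(E,1) = 0`, `ord_{s=1} L(E,s) = 1`;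
`Ш(E/ℚ)` finite; `Ω(W) = u·Ω⁺_{D.f}` with `|u|_p = 1`; `ℓ` a Kolyvagin prime of level `2`
(`ℓ ∤ Np`, `ℓ ≡ 1`, `a_ℓ ≡ ℓ + 1 (mod p²)`) with `#Ẽ(𝔽_ℓ)[p] ≤ p`; `ψ` with `ψ_ℓ : (ℤ/ℓ)ˣ ↠ ℤ/p²`
and `kuriharaNumber D.f (p²) ℓ ψ ≠ 0` (so `ord(δ̃) = 1` and `∂^{(1)}(δ̃) ≤ 1`). Then
`length_{ℤ_p} Ш(E/ℚ)[p^∞] = ∂^{(1)}(δ̃) − ∂^{(∞)}(δ̃) ≤ 1`: `ord_p #Ш(E/ℚ)(p) ≤ 1`. Weaker than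
print, never stronger. No `_holds` (size XL).
[cite: Kim2022StructureSelmer, Thm. 1.9 (6) (PDF p. 8), §1.2.2 (PDF p. 5), §1.4.1 and §1.4.3–1.4.4 (PDF p. 7), §1.5.1 (PDF p. 7), §1.3.5 (PDF p. 6), Conj. 1.10 (PDF p. 8)] -/
def Kim2022_rankOne_padicValNat_sha_le_one_of_kuriharaNumber_levelTwo_ne_zero_of_maninConstant :
    Prop :=
  ∀ (W : WeierstrassCurve ℚ) [W.IsElliptic] [W.IsGloballyMinimal] (p : ℕ) [Fact p.Prime],
    5 ≤ p → W.HasSurjectiveModNGaloisRep p →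
    W.entireLFunction 1 = 0 → W.analyticRank = 1 → Finite W.sha →
    ∀ {N : ℕ} [NeZero N] (D : ModularParametrizationData W N),
    ¬ (p : ℤ) ∣ D.maninConstant →
    (∃ u : ℚ, ‖(u : ℚ_[p])‖ = 1 ∧ W.realPeriodRat = u * plusPeriod D.f) →
    ∀ (ℓ : ℕ) [Fact ℓ.Prime], Kato.IsKolyvaginPrime W p 2 ℓ →
    Nat.card {P : ((WeierstrassCurve.integralModelInt W).map
        (Int.castRingHom (ZMod ℓ))).toAffine.Point // p • P = 0} ≤ p →
    ∀ ψ : (ℓ' : ℕ) → (ZMod ℓ')ˣ →* Multiplicative (ZMod (p ^ 2)),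
      Function.Surjective (ψ ℓ) →
      kuriharaNumber D.f (p ^ 2) ℓ ψ ≠ 0 →
    padicValNat p (Nat.card (AddCommGroup.primaryComponent W.sha p)) ≤ 1

end Literature.NumberTheory.EllipticCurves

end
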